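import Summits.AnomalousDissipation.AnomalousDissipation.Theorems.MarginalStabilityChainBurgersLayerKHStubStrainedG

/-!
# Line `Sketch`, stub `stub_strained` (lead) — part H

part H: uniform Gaussian-class integral bounds, the Gaussian bound transferred by uniqueness, and the two a-priori
estimates `lipschitz_apriori` (in `λ`) and `close_apriori` (`O(h)` to any `h = 0` slow mode, using the whole-line
integration by parts).
-/

set_option linter.dupNamespace false

noncomputable section

open Complex MeasureTheory Filter Topology Set Metric intervalIntegral

namespace Summit.AnomalousDissipation.AnomalousDissipation.Theorems.BurgersLayerKH.Sheet.Strained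

/-! ## §L Assembly of `StrainedPackage` -/

/-- Uniform bounds over the Gaussian class: `∫ e^{αt} Ω` and `∫_{t>y} k_α(t-y) e^{αt} Ω(t) dt`. [folklore] -/
theorem exp_gauss_bounds {α : ℝ} (hα : 0 < α) : ∃ C₀ : ℝ, 0 < C₀ ∧ ∀ (Ω : ℝ → ℂ) (CΩ : ℝ), Continuous Ω →
    GaussBound Ω CΩ → Integrable (fun t => (Real.exp (α * t) : ℂ) * Ω t) ∧
      ‖∫ t : ℝ, (Real.exp (α * t) : ℂ) * Ω t‖ ≤ |CΩ| * C₀ ∧ ∀ y : ℝ,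
      IntegrableOn (fun t => (volterraKernel α (t - y) : ℂ) * ((Real.exp (α * t) : ℂ) * Ω t)) (Ioi y) ∧
      ‖∫ t in Ioi y, (volterraKernel α (t - y) : ℂ) * ((Real.exp (α * t) : ℂ) * Ω t)‖ ≤ |CΩ| * C₀ / (2 * α) := by
  obtain ⟨C₀, hC₀, hb⟩ := peg_integral_bound 0 α
  refine ⟨C₀, hC₀, fun Ω CΩ hc hG => ?_⟩
  have h := hb (fun t => (Real.exp (α * t) : ℂ) * Ω t) (by fun_prop) CΩ fun t => by
    rw [norm_mul, Complex.norm_real, Real.norm_of_nonneg (Real.exp_pos _).le, pow_zero, one_mul]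
    calc Real.exp (α * t) * ‖Ω t‖ ≤ Real.exp (α * t) * (CΩ * Real.exp (-(t ^ 2) / 4)) :=
          mul_le_mul_of_nonneg_left (hG t) (Real.exp_pos _).le
      _ = CΩ * (Real.exp (α * t) * Real.exp (-(t ^ 2) / 4)) := by ring
  obtain ⟨hint, hle⟩ := h
  have hCΩ : 0 ≤ CΩ := GaussBound.nonneg hG
  refine ⟨hint, (MeasureTheory.norm_integral_le_integral_norm _).trans hle, fun y => ?_⟩
  have hi : IntegrableOn (fun t => (volterraKernel α (t - y) : ℂ) * ((Real.exp (α * t) : ℂ) * Ω t)) (Ioi y) := by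
    have := integrableOn_kernel_exp hα (q := Ω) (M := CΩ) hc (fun t => by
      calc ‖Ω t‖ ≤ CΩ * Real.exp (-(t ^ 2) / 4) := hG t
        _ = CΩ * 1 * Real.exp (-(t ^ 2) / 4) := by ring
        _ ≤ CΩ * (1 + |t|) * Real.exp (-(t ^ 2) / 4) := by gcongr; linarith [abs_nonneg t]) y
    exact this.congr_fun (fun t _ => by ring) measurableSet_Ioi
  refine ⟨hi, ?_⟩
  calc ‖∫ t in Ioi y, (volterraKernel α (t - y) : ℂ) * ((Real.exp (α * t) : ℂ) * Ω t)‖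
      ≤ ∫ t in Ioi y, ‖(volterraKernel α (t - y) : ℂ) * ((Real.exp (α * t) : ℂ) * Ω t)‖ :=
        MeasureTheory.norm_integral_le_integral_norm _
    _ ≤ ∫ t in Ioi y, 1 / (2 * α) * ‖(Real.exp (α * t) : ℂ) * Ω t‖ := by
        refine integral_mono_ae hi.norm ((hint.norm.const_mul _).integrableOn) ?_
        refine (ae_restrict_iff' measurableSet_Ioi).2 (ae_of_all _ fun t (ht : y < t) => ?_)
        obtain ⟨hk0, hk1⟩ := volterraKernel_bounds hα (sub_nonneg.2 ht.le)
        beta_reduce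
        rw [norm_mul, Complex.norm_of_nonneg hk0]
        exact mul_le_mul_of_nonneg_right hk1 (norm_nonneg _)
    _ ≤ ∫ t, 1 / (2 * α) * ‖(Real.exp (α * t) : ℂ) * Ω t‖ :=
        setIntegral_le_integral (hint.norm.const_mul _) (ae_of_all _ fun t => by positivity)
    _ = 1 / (2 * α) * ∫ t, ‖(Real.exp (α * t) : ℂ) * Ω t‖ := MeasureTheory.integral_const_mul _ _
    _ ≤ 1 / (2 * α) * (|CΩ| * C₀) := by gcongr
    _ = |CΩ| * C₀ / (2 * α) := by ring

/-- The Gaussian bound transferred by uniqueness from the resolvent package. [folklore] -/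
theorem gaussBound_of_unique {α h ℓ K : ℝ} {lam : ℂ} {F W : ℝ → ℂ} {C_F : ℝ} (hα : 0 < α) (hα1 : α ≤ 1) (hℓ : 0 < ℓ) (hlam : ℓ ≤ lam.re) (hh : 0 < h) (hhℓ : h ≤ lam.re) (hRes : ResolventBound K) (hUq : ResolventUniqueAt α h lam) (hFc : Continuous F) (hF : GaussBound F C_F) (hW : IsResolventSol α h lam F W) : GaussBound W (|K| * C_F / ℓ) := by
  have hlam0 : 0 < lam.re := hℓ.trans_le hlam
  have hCF : 0 ≤ C_F := GaussBound.nonneg hF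
  obtain ⟨W', hW', hb⟩ := hRes α hα hα1 lam hlam0 h hh hhℓ F hFc C_F hF
  rw [resSol_unique hUq hW hW']
  refine GaussBound.mono hb ?_
  calc K * C_F / lam.re ≤ |K| * C_F / lam.re :=
        div_le_div_of_nonneg_right (mul_le_mul_of_nonneg_right (le_abs_self K) hCF) hlam0.le
    _ ≤ |K| * C_F / ℓ := div_le_div_of_nonneg_left (by positivity) hℓ hlam

/-- **Lipschitz dependence on `λ` of `∫ e^{αt} Ω_λ`** for slow fixed points (a priori). [folklore] -/
theorem lipschitz_apriori {α ℓ K : ℝ} (hα : 0 < α) (hα1 : α ≤ 1) (hℓ : 0 < ℓ)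
    (hVolt : VolterraPackage 1 (1 / ℓ)) (hRes : ResolventBound K)
    (hUq : ∀ lam : ℂ, 0 < lam.re → ∀ h : ℝ, 0 < h → ResolventUniqueAt α h lam) :
    ∃ h₀ : ℝ, 0 < h₀ ∧ ∃ L : ℝ, 0 ≤ L ∧ ∀ h : ℝ, 0 < h → h ≤ h₀ → ∀ lam₁ lam₂ : ℂ, ℓ ≤ lam₁.re → ℓ ≤ lam₂.re →
      ∀ (m₁ Ω₁ m₂ Ω₂ : ℝ → ℂ) (B : ℝ), Continuous m₁ → Continuous m₂ →
      (∀ y, ‖m₁ y‖ ≤ B * (1 + |y|)) → (∀ y, ‖m₂ y‖ ≤ B * (1 + |y|)) →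
      IsResolventSol α h lam₁ (fun t => -(I * Upp t) * ((Real.exp (-(α * t)) : ℂ) * m₁ t)) Ω₁ →
      IsResolventSol α h lam₂ (fun t => -(I * Upp t) * ((Real.exp (-(α * t)) : ℂ) * m₂ t)) Ω₂ →
      (∀ y, m₁ y = 1 - ∫ t in Ioi y, (volterraKernel α (t - y) : ℂ) * ((Real.exp (α * t) : ℂ) * Ω₁ t)) →
      (∀ y, m₂ y = 1 - ∫ t in Ioi y, (volterraKernel α (t - y) : ℂ) * ((Real.exp (α * t) : ℂ) * Ω₂ t)) →
      ‖(∫ t : ℝ, (Real.exp (α * t) : ℂ) * Ω₁ t) - ∫ t : ℝ, (Real.exp (α * t) : ℂ) * Ω₂ t‖ ≤ L * B * ‖lam₁ - lam₂‖ := by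
  obtain ⟨h₂, hh₂, CS, hCS0, hST⟩ := slow_stability hα hα1 hℓ hVolt hRes hUq
  obtain ⟨C₀, hC₀, hEG⟩ := exp_gauss_bounds hα
  set h₀ : ℝ := min h₂ ℓ with hh₀
  refine ⟨h₀, lt_min hh₂ hℓ, C₀ * (|K| * Real.exp 9 * CS * (|K| * (|K| * Real.exp 9 / ℓ) / ℓ * C₀ / (2 * α)) / ℓ +
      |K| * (|K| * Real.exp 9 / ℓ) / ℓ), by positivity, ?_⟩
  intro h hh hhle lam₁ lam₂ hlam₁ hlam₂ m₁ Ω₁ m₂ Ω₂ B hm₁c hm₂c hm₁b hm₂b hΩ₁ hΩ₂ hm₁ hm₂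
  have hlam₁0 : 0 < lam₁.re := hℓ.trans_le hlam₁
  have hlam₂0 : 0 < lam₂.re := hℓ.trans_le hlam₂
  have hhℓ₁ : h ≤ lam₁.re := (hhle.trans (min_le_right _ _)).trans hlam₁
  have hhℓ₂ : h ≤ lam₂.re := (hhle.trans (min_le_right _ _)).trans hlam₂
  have hh₂' : h ≤ h₂ := hhle.trans (min_le_left _ _)
  have hB : 0 ≤ B := by have := (norm_nonneg _).trans (hm₁b 0); simpa using this
  -- Gaussian bounds of `Ω₂`
  have hF₂c : Continuous fun t => -(I * Upp t) * ((Real.exp (-(α * t)) : ℂ) * m₂ t) := by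
    have h1 := hm₂c; have h2 := SheetLimit.continuous_Upp; fun_prop
  have hF₂b := gaussBound_source hα.le hα1 hm₂b
  have hΩ₂b : GaussBound Ω₂ (|K| * (Real.exp 9 * B) / ℓ) :=
    gaussBound_of_unique hα hα1 hℓ hlam₂ hh hhℓ₂ hRes (hUq lam₂ hlam₂0 h hh) hF₂c hF₂b hΩ₂
  -- `u` : the resolvent solution AT `λ₁` for the source of `m₂`
  obtain ⟨u, hu, -⟩ := hRes α hα hα1 lam₁ hlam₁0 h hh hhℓ₁ _ hF₂c _ hF₂b
  -- (i) `u - Ω₂` solves at `λ₁` with source `(λ₂ - λ₁) Ω₂`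
  have hdiff := resSol_sub_param hu hΩ₂
  have hsrcc : Continuous fun y => (lam₂ - lam₁) * Ω₂ y := continuous_const.mul hΩ₂.1.continuous
  have hsrcb : GaussBound (fun y => (lam₂ - lam₁) * Ω₂ y) (‖lam₁ - lam₂‖ * (|K| * (Real.exp 9 * B) / ℓ)) := by
    intro y
    rw [norm_mul, ← norm_neg (lam₂ - lam₁), neg_sub, mul_assoc]
    exact mul_le_mul_of_nonneg_left (hΩ₂b y) (norm_nonneg _)
  have huΩ₂ : GaussBound (fun y => u y - Ω₂ y) (|K| * (‖lam₁ - lam₂‖ * (|K| * (Real.exp 9 * B) / ℓ)) / ℓ) :=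
    gaussBound_of_unique hα hα1 hℓ hlam₁ hh hhℓ₁ hRes (hUq lam₁ hlam₁0 h hh) hsrcc hsrcb hdiff
  have huΩ₂c : Continuous fun y => u y - Ω₂ y := hu.1.continuous.sub hΩ₂.1.continuous
  -- (ii) stability: `m₂ = g' - ∫ k e^{αt} u`, `g' = 1 + ∫ k e^{αt} (u - Ω₂)`
  obtain ⟨CΩu, hCΩu⟩ := hu.2.1
  obtain ⟨CΩ2, hCΩ2⟩ := hΩ₂.2.1
  set g' : ℝ → ℂ := fun y => 1 + ∫ t in Ioi y, (volterraKernel α (t - y) : ℂ) * ((Real.exp (α * t) : ℂ) * (u t - Ω₂ t))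
    with hg'
  have hm₂' : ∀ y, m₂ y = g' y - ∫ t in Ioi y, (volterraKernel α (t - y) : ℂ) * ((Real.exp (α * t) : ℂ) * u t) := by
    intro y
    have hi1 := ((hEG u CΩu hu.1.continuous hCΩu).2.2 y).1
    have hi2 := ((hEG Ω₂ CΩ2 hΩ₂.1.continuous hCΩ2).2.2 y).1
    simp only [hg']
    rw [hm₂ y]
    have : (∫ t in Ioi y, (volterraKernel α (t - y) : ℂ) * ((Real.exp (α * t) : ℂ) * (u t - Ω₂ t))) =
        (∫ t in Ioi y, (volterraKernel α (t - y) : ℂ) * ((Real.exp (α * t) : ℂ) * u t)) -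
          ∫ t in Ioi y, (volterraKernel α (t - y) : ℂ) * ((Real.exp (α * t) : ℂ) * Ω₂ t) := by
      rw [← integral_sub hi1 hi2]; exact integral_congr_ae (ae_of_all _ fun t => by ring)
    rw [this]; ring
  have hc₂ : 0 ≤ |K| * (‖lam₁ - lam₂‖ * (|K| * (Real.exp 9 * B) / ℓ)) / ℓ := by positivity
  set δ : ℝ := (|K| * (‖lam₁ - lam₂‖ * (|K| * (Real.exp 9 * B) / ℓ)) / ℓ) * C₀ / (2 * α) with hδ
  have hδ0 : 0 ≤ δ := by positivity
  have hgg' : ∀ y, ‖(1 : ℂ) - g' y‖ ≤ δ := by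
    intro y
    simp only [hg']
    rw [sub_add_cancel_left, norm_neg]
    have := ((hEG _ _ huΩ₂c huΩ₂).2.2 y).2
    rwa [abs_of_nonneg hc₂] at this
  have hstab := hST h hh hh₂' lam₁ hlam₁ m₁ m₂ Ω₁ u (fun _ => 1) g' B δ hm₁c hm₂c hm₁b hm₂b hΩ₁ hu hm₁ hm₂' hgg'
  -- (iii) `Ω₁ - u` solves at `λ₁` with source attached to `m₁ - m₂`
  have hW : IsResolventSol α h lam₁ (fun t => -(I * Upp t) * ((Real.exp (-(α * t)) : ℂ) * (m₁ t - m₂ t)))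
      (fun t => Ω₁ t - u t) := by
    have h2 := resSol_add hΩ₁ (resSol_smul hu (-1))
    have hF : (fun y => -(I * ↑(Upp y)) * (↑(Real.exp (-(α * y))) * m₁ y) +
        -1 * (-(I * ↑(Upp y)) * (↑(Real.exp (-(α * y))) * m₂ y))) =
        fun t => -(I * Upp t) * ((Real.exp (-(α * t)) : ℂ) * (m₁ t - m₂ t)) := by
      funext t; ring
    have hWf : (fun y => Ω₁ y + -1 * u y) = fun t => Ω₁ t - u t := by funext t; ring
    rw [hF, hWf] at h2; exact h2
  have hdB : ∀ y, ‖m₁ y - m₂ y‖ ≤ (CS * δ) * (1 + |y|) := hstab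
  have hWb : GaussBound (fun t => Ω₁ t - u t) (|K| * (Real.exp 9 * (CS * δ)) / ℓ) :=
    gaussBound_of_unique hα hα1 hℓ hlam₁ hh hhℓ₁ hRes (hUq lam₁ hlam₁0 h hh)
      (by have h1 := hm₁c; have h2 := hm₂c; have h3 := SheetLimit.continuous_Upp; fun_prop)
      (gaussBound_source hα.le hα1 hdB) hW
  have hWc : Continuous fun t => Ω₁ t - u t := hΩ₁.1.continuous.sub hu.1.continuous
  -- (iv) the integrals
  obtain ⟨CΩ1, hCΩ1⟩ := hΩ₁.2.1
  have hI1 := (hEG Ω₁ CΩ1 hΩ₁.1.continuous hCΩ1).1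
  have hI2 := (hEG Ω₂ CΩ2 hΩ₂.1.continuous hCΩ2).1
  have hIu := (hEG u CΩu hu.1.continuous hCΩu).1
  have hA := (hEG _ _ hWc hWb).2.1
  have hB' := (hEG _ _ huΩ₂c huΩ₂).2.1
  have hsplit : (∫ t : ℝ, (Real.exp (α * t) : ℂ) * Ω₁ t) - (∫ t : ℝ, (Real.exp (α * t) : ℂ) * Ω₂ t) =
      (∫ t : ℝ, (Real.exp (α * t) : ℂ) * (Ω₁ t - u t)) + ∫ t : ℝ, (Real.exp (α * t) : ℂ) * (u t - Ω₂ t) := by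
    rw [← integral_sub hI1 hI2, ← MeasureTheory.integral_add]
    · exact integral_congr_ae (ae_of_all _ fun t => by ring)
    · exact (hI1.sub hIu).congr (ae_of_all _ fun t => by simp only [Pi.sub_apply]; ring)
    · exact (hIu.sub hI2).congr (ae_of_all _ fun t => by simp only [Pi.sub_apply]; ring)
  rw [hsplit]
  have hc₁ : 0 ≤ |K| * (Real.exp 9 * (CS * δ)) / ℓ := by positivity
  rw [abs_of_nonneg hc₁] at hA
  rw [abs_of_nonneg hc₂] at hB'
  calc ‖(∫ t : ℝ, (Real.exp (α * t) : ℂ) * (Ω₁ t - u t)) + ∫ t : ℝ, (Real.exp (α * t) : ℂ) * (u t - Ω₂ t)‖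
      ≤ (|K| * (Real.exp 9 * (CS * δ)) / ℓ) * C₀ + (|K| * (‖lam₁ - lam₂‖ * (|K| * (Real.exp 9 * B) / ℓ)) / ℓ) * C₀ :=
        (norm_add_le _ _).trans (add_le_add hA hB')
    _ = _ := by
        rw [hδ]
        field_simp

/-- **`O(h)` closeness of `∫ e^{αt} Ω_h` to `∫ e^{αt} ω₀`** for the slow fixed point and ANY `h = 0`
slow mode at the same `(α, λ)` (a priori). [folklore] -/
theorem close_apriori {α ℓ K : ℝ} (hα : 0 < α) (hα1 : α ≤ 1) (hℓ : 0 < ℓ)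
    (hVolt : VolterraPackage 1 (1 / ℓ)) (hRes : ResolventBound K)
    (hUq : ∀ lam : ℂ, 0 < lam.re → ∀ h : ℝ, 0 < h → ResolventUniqueAt α h lam) :
    ∃ h₀ : ℝ, 0 < h₀ ∧ ∃ Lc : ℝ, 0 ≤ Lc ∧ ∀ h : ℝ, 0 < h → h ≤ h₀ → ∀ lam : ℂ, ℓ ≤ lam.re →
      ∀ (m Ω : ℝ → ℂ) (B : ℝ), Continuous m → (∀ y, ‖m y‖ ≤ B * (1 + |y|)) →
      IsResolventSol α h lam (fun t => -(I * Upp t) * ((Real.exp (-(α * t)) : ℂ) * m t)) Ω →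
      (∀ y, m y = 1 - ∫ t in Ioi y, (volterraKernel α (t - y) : ℂ) * ((Real.exp (α * t) : ℂ) * Ω t)) →
      ∀ ψ₀ : ℝ → ℂ, IsSlowMode α 0 lam ψ₀ →
      ‖(∫ t : ℝ, (Real.exp (α * t) : ℂ) * Ω t) - ∫ t : ℝ, (Real.exp (α * t) : ℂ) * vort α ψ₀ t‖ ≤ Lc * h := by
  obtain ⟨CV, hCV⟩ := id hVolt
  obtain ⟨h₂, hh₂, CS, hCS0, hST⟩ := slow_stability hα hα1 hℓ hVolt hRes hUq
  obtain ⟨C₀, hC₀, hEG⟩ := exp_gauss_bounds hα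
  obtain ⟨Cstar, hCstar0, hIBP⟩ := ibp_estimate hα hℓ
  set CV' : ℝ := max CV 1 with hCV'
  have hCV'0 : 0 < CV' := lt_of_lt_of_le zero_lt_one (le_max_right _ _)
  set Cu : ℝ := |K| * (Real.exp 9 * CV') / ℓ with hCu
  have hCu0 : 0 ≤ Cu := by positivity
  set h₀ : ℝ := min h₂ ℓ with hh₀
  refine ⟨h₀, lt_min hh₂ hℓ, C₀ * (|K| * (Real.exp 9 * (CS * (Cstar * Cu))) / ℓ) + 2 * α * (Cstar * Cu),
    by positivity, ?_⟩
  intro h hh hhle lam hlam m Ω B hmc hmb hΩ hm ψ₀ hψ₀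
  have hlam0 : 0 < lam.re := hℓ.trans_le hlam
  have hhℓ : h ≤ lam.re := (hhle.trans (min_le_right _ _)).trans hlam
  have hh₂' : h ≤ h₂ := hhle.trans (min_le_left _ _)
  have hden : ∀ t, lam + I * (U t : ℂ) ≠ 0 := lam_add_ne_zero hlam0
  -- the `h = 0` mode: `m₀ = e^{αy} ψ₀`, its vorticity and Volterra form
  obtain ⟨hC4, heq0, ⟨Cω, hCω⟩, hlim0, ⟨B₀, hB₀⟩⟩ := id hψ₀
  set m₀ : ℝ → ℂ := fun y => (Real.exp (α * y) : ℂ) * ψ₀ y with hm₀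
  have hm₀c : Continuous m₀ := by have := hC4.continuous; simp only [hm₀]; fun_prop
  have hweight : ∀ y, (Real.exp (-(α * y)) : ℂ) * m₀ y = ψ₀ y := by
    intro y; simp only [hm₀]
    rw [← mul_assoc, ← Complex.ofReal_mul, ← Real.exp_add, neg_add_cancel, Real.exp_zero, Complex.ofReal_one, one_mul]
  have hvol : ∀ y, m₀ y = 1 - ∫ t in Ioi y, (volterraKernel α (t - y) : ℂ) * ((Real.exp (α * t) : ℂ) * vort α ψ₀ t) :=
    fun y => volterraForm_of_slowMode_zero hα hψ₀ y
  have hωeq : ∀ t, vort α ψ₀ t = (-(I * Upp t) * ((Real.exp (-(α * t)) : ℂ) * m₀ t)) / (lam + I * U t) := by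
    intro t
    have := heq0 t
    rw [Complex.ofReal_zero, zero_mul, sub_zero] at this
    rw [eq_div_iff (hden t), hweight t, mul_comm]
    exact this
  -- uniform linear bound of `m₀` via the Volterra package (`m₀ = 1 + ∫ k V m₀`)
  obtain ⟨V, hV⟩ : ∃ V : ℝ → ℂ, V = fun t => I * (Upp t : ℂ) / (lam + I * (U t : ℂ)) := ⟨_, rfl⟩
  have hVc : Continuous V := by
    rw [hV]; have h1 := SheetLimit.continuous_Upp; have h2 := differentiable_U.continuous
    exact Continuous.div (by fun_prop) (by fun_prop) hden
  have hVb : ∀ t, ‖V t‖ ≤ 1 / ℓ * Real.exp (-(t ^ 2) / 4) := by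
    intro t
    rw [hV]; simp only
    rw [norm_div, norm_mul, Complex.norm_I, one_mul, Complex.norm_real, Real.norm_eq_abs]
    have hUpp : |Upp t| = |t| * Real.exp (-(t ^ 2) / 2) := by
      rw [Upp, abs_neg, abs_mul, abs_of_pos (Real.exp_pos _)]
    have hte : |t| * Real.exp (-(t ^ 2) / 2) ≤ Real.exp (-(t ^ 2) / 4) := by
      have h1 : |t| ≤ Real.exp (t ^ 2 / 4) := by
        have := Real.add_one_le_exp (t ^ 2 / 4)
        nlinarith [sq_nonneg (|t| - 2), sq_abs t]
      calc |t| * Real.exp (-(t ^ 2) / 2) ≤ Real.exp (t ^ 2 / 4) * Real.exp (-(t ^ 2) / 2) :=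
            mul_le_mul_of_nonneg_right h1 (Real.exp_pos _).le
        _ = Real.exp (-(t ^ 2) / 4) := by rw [← Real.exp_add]; congr 1; ring
    rw [hUpp, div_eq_mul_inv, mul_comm, one_div]
    exact mul_le_mul (inv_anti₀ hℓ (hlam.trans (re_le_norm_lam_add lam t))) hte (by positivity) (by positivity)
  have hm₀vol : ∀ y, m₀ y = 1 + ∫ t in Ioi y, (volterraKernel α (t - y) : ℂ) * V t * m₀ t := by
    intro y
    rw [hvol y, sub_eq_add_neg, ← MeasureTheory.integral_neg]
    congr 1
    refine integral_congr_ae (ae_of_all _ fun t => ?_)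
    simp only
    rw [hωeq t, hV]
    have hE : (Real.exp (α * t) : ℂ) * (Real.exp (-(α * t)) : ℂ) = 1 := by
      rw [← Complex.ofReal_mul, ← Real.exp_add, add_neg_cancel, Real.exp_zero, Complex.ofReal_one]
    simp only [div_eq_mul_inv]
    linear_combination ((volterraKernel α (t - y) : ℂ) * I * (Upp t : ℂ) * m₀ t * (lam + I * (U t : ℂ))⁻¹) * hE
  have hm₀B : ∀ y, ‖m₀ y‖ ≤ CV' * (1 + |y|) := by
    obtain ⟨⟨s, hsc, hsb, hseq⟩, huniq⟩ := hCV α hα.le hα1 V hVc hVb (fun _ => (1 : ℂ)) continuous_const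
      (fun y => by rw [norm_one, pow_one]; linarith [abs_nonneg y])
    have hB₀' : ∀ y, ‖m₀ y‖ ≤ B₀ * (1 + |y|) ^ 1 := fun y => by rw [pow_one]; exact hB₀ y
    have heq := huniq m₀ s hm₀c hsc ⟨B₀, hB₀'⟩ ⟨CV, hsb⟩ hm₀vol hseq
    intro y
    rw [heq]
    have := hsb y
    rw [pow_one] at this
    exact this.trans (mul_le_mul_of_nonneg_right (le_max_left _ _) (by positivity))
  -- `u₀` : the `h`-resolvent solution for the source of `m₀`
  have hF₀c : Continuous fun t => -(I * Upp t) * ((Real.exp (-(α * t)) : ℂ) * m₀ t) := by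
    have h1 := hm₀c; have h2 := SheetLimit.continuous_Upp; fun_prop
  have hF₀b := gaussBound_source hα.le hα1 hm₀B
  obtain ⟨u₀, hu₀, -⟩ := hRes α hα hα1 lam hlam0 h hh hhℓ _ hF₀c _ hF₀b
  have hu₀b : GaussBound u₀ Cu := gaussBound_of_unique hα hα1 hℓ hlam hh hhℓ hRes (hUq lam hlam0 h hh) hF₀c hF₀b hu₀
  obtain ⟨D, -, hD⟩ := resSol_deriv_decay hu₀ hh.ne' hF₀b
  obtain ⟨D', hD'⟩ := ou_bound_of_resSol hu₀ hh hF₀b hu₀b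
  -- `u₀ - ω₀ = h · ou(u₀)/(λ+iU)`
  have hdec : ∀ t, u₀ t - vort α ψ₀ t = (h : ℂ) * (ou α u₀ t / (lam + I * U t)) := by
    intro t
    have := resSol_decomp hu₀ hlam0 t
    rw [hωeq t, this]; ring
  -- the representation of `m₀` AT `h` and the stability estimate
  set g' : ℝ → ℂ := fun y => 1 + (h : ℂ) * ∫ t in Ioi y,
      (volterraKernel α (t - y) : ℂ) * (Real.exp (α * t) : ℂ) * (ou α u₀ t / (lam + I * U t)) with hg'
  have hqc : Continuous fun t => ou α u₀ t / (lam + I * U t) :=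
    Continuous.div (continuous_ou hu₀.1) (by have := differentiable_U.continuous; fun_prop) hden
  have hqb : ∀ t, ‖ou α u₀ t / (lam + I * U t)‖ ≤ D' / ℓ * (1 + |t|) * Real.exp (-(t ^ 2) / 4) := by
    intro t
    rw [norm_div]
    have hD'0 : 0 ≤ D' * (1 + |t|) * Real.exp (-(t ^ 2) / 4) := (norm_nonneg _).trans (hD' t)
    calc ‖ou α u₀ t‖ / ‖lam + I * U t‖ ≤ (D' * (1 + |t|) * Real.exp (-(t ^ 2) / 4)) / ℓ :=
          div_le_div₀ hD'0 (hD' t) hℓ (hlam.trans (re_le_norm_lam_add lam t))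
      _ = D' / ℓ * (1 + |t|) * Real.exp (-(t ^ 2) / 4) := by ring
  obtain ⟨Cωu, hCωu⟩ := hu₀.2.1
  have hωc : Continuous (vort α ψ₀) := by
    have : vort α ψ₀ = fun y => -(iteratedDeriv 2 ψ₀ y - (α : ℂ) ^ 2 * ψ₀ y) := by funext y; rw [vort]
    rw [this]
    exact ((hC4.continuous_iteratedDeriv 2 (by norm_num)).sub (continuous_const.mul hC4.continuous)).neg
  have hm₀' : ∀ y, m₀ y = g' y - ∫ t in Ioi y, (volterraKernel α (t - y) : ℂ) * ((Real.exp (α * t) : ℂ) * u₀ t) := by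
    intro y
    have hi1 := ((hEG u₀ Cωu hu₀.1.continuous hCωu).2.2 y).1
    have hi2 := ((hEG (vort α ψ₀) Cω hωc hCω).2.2 y).1
    have hi3 := integrableOn_kernel_exp hα hqc hqb y
    simp only [hg']
    rw [hvol y]
    have : (∫ t in Ioi y, (volterraKernel α (t - y) : ℂ) * ((Real.exp (α * t) : ℂ) * u₀ t)) -
        (∫ t in Ioi y, (volterraKernel α (t - y) : ℂ) * ((Real.exp (α * t) : ℂ) * vort α ψ₀ t)) =
        (h : ℂ) * ∫ t in Ioi y, (volterraKernel α (t - y) : ℂ) * (Real.exp (α * t) : ℂ) * (ou α u₀ t / (lam + I * U t)) := by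
      rw [← integral_sub hi1 hi2, ← MeasureTheory.integral_const_mul]
      refine integral_congr_ae (ae_of_all _ fun t => ?_)
      simp only
      have := hdec t
      linear_combination ((volterraKernel α (t - y) : ℂ) * (Real.exp (α * t) : ℂ)) * this
    linear_combination this
  have hgg' : ∀ y, ‖(1 : ℂ) - g' y‖ ≤ h * (Cstar * Cu) := by
    intro y
    simp only [hg']
    rw [sub_add_cancel_left, norm_neg, norm_mul, Complex.norm_real, Real.norm_of_nonneg hh.le]
    exact mul_le_mul_of_nonneg_left (hIBP lam hlam u₀ hu₀.1 _ D D' hu₀b hD hD' y) hh.le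
  set Bmax : ℝ := max B CV' with hBmax
  have hmB' : ∀ y, ‖m y‖ ≤ Bmax * (1 + |y|) := fun y => (hmb y).trans (mul_le_mul_of_nonneg_right (le_max_left _ _) (by positivity))
  have hm₀B' : ∀ y, ‖m₀ y‖ ≤ Bmax * (1 + |y|) := fun y => (hm₀B y).trans (mul_le_mul_of_nonneg_right (le_max_right _ _) (by positivity))
  have hstab := hST h hh hh₂' lam hlam m m₀ Ω u₀ (fun _ => 1) g' Bmax (h * (Cstar * Cu)) hmc hm₀c hmB' hm₀B' hΩ hu₀
    hm hm₀' hgg'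
  -- `Ω - u₀` : resolvent solution for the source of `m - m₀`
  have hW : IsResolventSol α h lam (fun t => -(I * Upp t) * ((Real.exp (-(α * t)) : ℂ) * (m t - m₀ t))) (fun t => Ω t - u₀ t) := by
    have h2 := resSol_add hΩ (resSol_smul hu₀ (-1))
    have hF : (fun y => -(I * ↑(Upp y)) * (↑(Real.exp (-(α * y))) * m y) +
        -1 * (-(I * ↑(Upp y)) * (↑(Real.exp (-(α * y))) * m₀ y))) =
        fun t => -(I * Upp t) * ((Real.exp (-(α * t)) : ℂ) * (m t - m₀ t)) := by
      funext t; ring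
    have hWf : (fun y => Ω y + -1 * u₀ y) = fun t => Ω t - u₀ t := by funext t; ring
    rw [hF, hWf] at h2; exact h2
  have hdB : ∀ y, ‖m y - m₀ y‖ ≤ (CS * (h * (Cstar * Cu))) * (1 + |y|) := hstab
  have hWb : GaussBound (fun t => Ω t - u₀ t) (|K| * (Real.exp 9 * (CS * (h * (Cstar * Cu)))) / ℓ) :=
    gaussBound_of_unique hα hα1 hℓ hlam hh hhℓ hRes (hUq lam hlam0 h hh)
      (by have h1 := hmc; have h2 := hm₀c; have h3 := SheetLimit.continuous_Upp; fun_prop)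
      (gaussBound_source hα.le hα1 hdB) hW
  have hWc : Continuous fun t => Ω t - u₀ t := hΩ.1.continuous.sub hu₀.1.continuous
  -- the two integrals
  obtain ⟨CΩ, hCΩ⟩ := hΩ.2.1
  have hI1 := (hEG Ω CΩ hΩ.1.continuous hCΩ).1
  have hIu := (hEG u₀ Cωu hu₀.1.continuous hCωu).1
  have hI0 := (hEG (vort α ψ₀) Cω hωc hCω).1
  have hA := (hEG _ _ hWc hWb).2.1
  -- the whole-line IBP term
  have hwhole : ‖∫ t : ℝ, (Real.exp (α * t) : ℂ) * (ou α u₀ t / (lam + I * U t))‖ ≤ 2 * α * (Cstar * Cu) := by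
    refine norm_integral_le_of_volterra_bound hα (n := 1) (M := D' / ℓ) hqc (fun t => ?_) fun y => ?_
    · calc ‖ou α u₀ t / (lam + I * U t)‖ ≤ D' / ℓ * (1 + |t|) * Real.exp (-(t ^ 2) / 4) := hqb t
        _ = D' / ℓ * ((1 + |t|) ^ 1 * Real.exp (-(t ^ 2) / 4)) := by ring
    · have := hIBP lam hlam u₀ hu₀.1 _ D D' hu₀b hD hD' y
      refine le_trans (le_of_eq ?_) this
      congr 1
      exact integral_congr_ae (ae_of_all _ fun t => by ring)
  have hIq : Integrable fun t => (Real.exp (α * t) : ℂ) * (ou α u₀ t / (lam + I * U t)) := by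
    have hM : 0 ≤ D' / ℓ := by have := (norm_nonneg _).trans (hqb 0); simpa using this
    refine (integrable_peg (M := D' / ℓ) (n := 1) (a := α) (by fun_prop) (fun t => ?_) 0).1
    rw [norm_mul, Complex.norm_real, Real.norm_of_nonneg (Real.exp_pos _).le, pow_one]
    calc Real.exp (α * t) * ‖ou α u₀ t / (lam + I * U t)‖
        ≤ Real.exp (α * t) * (D' / ℓ * (1 + |t|) * Real.exp (-(t ^ 2) / 4)) := mul_le_mul_of_nonneg_left (hqb t) (Real.exp_pos _).le
      _ = D' / ℓ * ((1 + |t|) * Real.exp (α * t) * Real.exp (-(t ^ 2) / 4)) := by ring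
  have hsplit : (∫ t : ℝ, (Real.exp (α * t) : ℂ) * Ω t) - (∫ t : ℝ, (Real.exp (α * t) : ℂ) * vort α ψ₀ t) =
      (∫ t : ℝ, (Real.exp (α * t) : ℂ) * (Ω t - u₀ t)) + (h : ℂ) * ∫ t : ℝ, (Real.exp (α * t) : ℂ) * (ou α u₀ t / (lam + I * U t)) := by
    rw [← integral_sub hI1 hI0, ← MeasureTheory.integral_const_mul, ← MeasureTheory.integral_add]
    · refine integral_congr_ae (ae_of_all _ fun t => ?_)
      have := hdec t
      simp only
      linear_combination (Real.exp (α * t) : ℂ) * this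
    · exact (hI1.sub hIu).congr (ae_of_all _ fun t => by simp only [Pi.sub_apply]; ring)
    · exact hIq.const_mul _
  rw [hsplit]
  have hc₁ : 0 ≤ |K| * (Real.exp 9 * (CS * (h * (Cstar * Cu)))) / ℓ := by positivity
  rw [abs_of_nonneg hc₁] at hA
  calc ‖(∫ t : ℝ, (Real.exp (α * t) : ℂ) * (Ω t - u₀ t)) + (h : ℂ) * ∫ t : ℝ, (Real.exp (α * t) : ℂ) * (ou α u₀ t / (lam + I * U t))‖
      ≤ (|K| * (Real.exp 9 * (CS * (h * (Cstar * Cu)))) / ℓ) * C₀ + h * (2 * α * (Cstar * Cu)) := by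
        refine (norm_add_le _ _).trans (add_le_add hA ?_)
        rw [norm_mul, Complex.norm_real, Real.norm_of_nonneg hh.le]
        exact mul_le_mul_of_nonneg_left hwhole hh.le
    _ = (C₀ * (|K| * (Real.exp 9 * (CS * (Cstar * Cu))) / ℓ) + 2 * α * (Cstar * Cu)) * h := by ring

end Summit.AnomalousDissipation.AnomalousDissipation.Theorems.BurgersLayerKH.Sheet.Strained

end
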